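import Summits.Ventures.YMGap.Thresholds.CouplingDerivativeTools
import Summits.Ventures.YMGap.RobustBall.Defs
import HarnessLib

/-!
# Venture YMGap, track ROBUST-BALL (Y2) — tools: geometry of three link sets and the trivial covariance bound

HONEST FRAMING. WHAT THIS IS: a venture tool file (cell `pub-ymgap`, track Y2 ROBUST-BALL, seat rb-p1, theorems only, no door, no number)
serving `LocalSourceMassGap.lean`:
* `exists_setDistEdges_eq` — a minimising pair for the `ℓ^∞` set-to-set distance `setDistEdges` of two nonempty link sets;
* `setDistEdges_le_two_mul_max_add` — `d(A, G) ≤ 2 · max(d(A ∪ S, G), d(G ∪ S, A)) + diam S` (triangle inequality through the source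
  set `S`); `setDistEdges_union_eq_zero_of_not_disjoint`, `setDistEdges_le_of_meets`;
* `abs_covariance_le_two_mul` — `|cov_μ(F, G)| ≤ 2 M_F M_G` for bounded measurable `F, G` on a probability space.
WHAT THIS IS NOT: pure bookkeeping; nothing about any model.
-/

noncomputable section

open MeasureTheory Function Finset Real ProbabilityTheory
open scoped NNReal
open Literature.Probability.LatticeModels
open Literature.MathematicalPhysics.QuantumLattice
open Literature.MathematicalPhysics.QuantumFieldTheory hiding ZdEdge Site
open Summit.Ventures.YMGap.CouplingResponse

namespace Summit.Ventures.YMGap.RobustBall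

variable {d : ℕ}

/-! ### Geometry of the three link sets -/

section Geometry

/-- A minimising pair for the set-to-set distance of two nonempty link sets. -/
theorem exists_setDistEdges_eq {Λ₁ Λ₂ : Finset (ZdEdge d)} (h₁ : Λ₁.Nonempty) (h₂ : Λ₂.Nonempty) :
    ∃ u ∈ Λ₁, ∃ v ∈ Λ₂, setDistEdges Λ₁ Λ₂ = ‖u.1 - v.1‖ := by
  have hne : (Λ₁ ×ˢ Λ₂).Nonempty := h₁.product h₂
  obtain ⟨p, hp, hpeq⟩ := Finset.exists_mem_eq_inf' hne (fun p : ZdEdge d × ZdEdge d => ‖p.1.1 - p.2.1‖)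
  refine ⟨p.1, (Finset.mem_product.1 hp).1, p.2, (Finset.mem_product.1 hp).2, ?_⟩
  rw [setDistEdges, dif_pos hne, hpeq]

/-- **`d(A, G) ≤ 2 · max(d(A ∪ S, G), d(G ∪ S, A)) + diam S`** for link sets `A, G, S` with `S` of `ℓ^∞`-diameter `≤ δ` (`δ ≥ 0`). -/
theorem setDistEdges_le_two_mul_max_add {A G S : Finset (ZdEdge d)} {δ : ℝ} (hδ0 : 0 ≤ δ)
    (hδ : ∀ s ∈ S, ∀ s' ∈ S, ‖s.1 - s'.1‖ ≤ δ) :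
    setDistEdges A G ≤ 2 * max (setDistEdges (A ∪ S) G) (setDistEdges (G ∪ S) A) + δ := by
  have hx0 := setDistEdges_nonneg (A ∪ S) G
  have hy0 := setDistEdges_nonneg (G ∪ S) A
  have hmax0 : 0 ≤ max (setDistEdges (A ∪ S) G) (setDistEdges (G ∪ S) A) := le_max_of_le_left hx0
  by_cases hA : A.Nonempty
  swap
  · have hp : ¬ (A ×ˢ G).Nonempty := fun ⟨p, hp⟩ => hA ⟨p.1, (Finset.mem_product.1 hp).1⟩
    rw [setDistEdges, dif_neg hp]; positivity
  by_cases hG : G.Nonempty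
  swap
  · rw [setDistEdges_of_not_nonempty hG]; positivity
  obtain ⟨u, hu, g, hg, hx⟩ := exists_setDistEdges_eq (hA.mono Finset.subset_union_left : (A ∪ S).Nonempty) hG
  obtain ⟨v, hv, a, ha, hy⟩ := exists_setDistEdges_eq (hG.mono Finset.subset_union_left : (G ∪ S).Nonempty) hA
  have hxle : setDistEdges (A ∪ S) G ≤ max (setDistEdges (A ∪ S) G) (setDistEdges (G ∪ S) A) := le_max_left _ _
  have hyle : setDistEdges (G ∪ S) A ≤ max (setDistEdges (A ∪ S) G) (setDistEdges (G ∪ S) A) := le_max_right _ _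
  rcases Finset.mem_union.1 hu with huA | huS
  · -- the minimiser of `d(A ∪ S, G)` lies in `A`
    calc setDistEdges A G ≤ ‖u.1 - g.1‖ := setDistEdges_le_norm_sub huA hg
      _ = setDistEdges (A ∪ S) G := hx.symm
      _ ≤ 2 * max (setDistEdges (A ∪ S) G) (setDistEdges (G ∪ S) A) + δ := by linarith
  rcases Finset.mem_union.1 hv with hvG | hvS
  · calc setDistEdges A G ≤ ‖a.1 - v.1‖ := setDistEdges_le_norm_sub ha hvG
      _ = ‖v.1 - a.1‖ := norm_sub_rev _ _
      _ = setDistEdges (G ∪ S) A := hy.symm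
      _ ≤ 2 * max (setDistEdges (A ∪ S) G) (setDistEdges (G ∪ S) A) + δ := by linarith
  · -- both minimisers start in `S`
    calc setDistEdges A G ≤ ‖a.1 - g.1‖ := setDistEdges_le_norm_sub ha hg
      _ = ‖(a.1 - v.1) + ((v.1 - u.1) + (u.1 - g.1))‖ := by congr 1; abel
      _ ≤ ‖a.1 - v.1‖ + (‖v.1 - u.1‖ + ‖u.1 - g.1‖) := (norm_add_le _ _).trans (add_le_add le_rfl (norm_add_le _ _))
      _ = setDistEdges (G ∪ S) A + (‖v.1 - u.1‖ + setDistEdges (A ∪ S) G) := by rw [hx, hy, norm_sub_rev a.1 v.1]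
      _ ≤ setDistEdges (G ∪ S) A + (δ + setDistEdges (A ∪ S) G) := by gcongr; exact hδ v hvS u huS
      _ ≤ 2 * max (setDistEdges (A ∪ S) G) (setDistEdges (G ∪ S) A) + δ := by linarith

/-- If `S` meets `Λ`, the distance from `Λ' ∪ S` to `Λ` vanishes. -/
theorem setDistEdges_union_eq_zero_of_not_disjoint {Λ Λ' S : Finset (ZdEdge d)} (h : ¬ Disjoint S Λ) :
    setDistEdges (Λ' ∪ S) Λ = 0 := by
  obtain ⟨s, hsS, hsΛ⟩ := Finset.not_disjoint_iff.1 h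
  have h1 := setDistEdges_le_norm_sub (Finset.mem_union_right Λ' hsS) hsΛ
  rw [sub_self, norm_zero] at h1
  exact le_antisymm h1 (setDistEdges_nonneg _ _)

/-- If `S` meets both `Λ_F` and `Λ_G`, then `d(Λ_F, Λ_G) ≤ diam S`. -/
theorem setDistEdges_le_of_meets {ΛF ΛG S : Finset (ZdEdge d)} {δ : ℝ} (hδ : ∀ s ∈ S, ∀ s' ∈ S, ‖s.1 - s'.1‖ ≤ δ)
    (hF : ¬ Disjoint S ΛF) (hG : ¬ Disjoint S ΛG) : setDistEdges ΛF ΛG ≤ δ := by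
  obtain ⟨s, hsS, hsF⟩ := Finset.not_disjoint_iff.1 hF
  obtain ⟨s', hs'S, hs'G⟩ := Finset.not_disjoint_iff.1 hG
  exact (setDistEdges_le_norm_sub hsF hs'G).trans (hδ s hsS s' hs'S)

end Geometry

/-! ### The covariance of two bounded observables is at most `2 M_F M_G` -/

section Trivial

variable {Ω : Type*} [MeasurableSpace Ω] {μ : Measure Ω} [IsProbabilityMeasure μ]

/-- `|cov_μ(F, G)| ≤ 2 M_F M_G` for bounded measurable `F, G`. -/
theorem abs_covariance_le_two_mul {F G : Ω → ℝ} (hFm : Measurable F) {MF : ℝ} (hMF : ∀ ω, |F ω| ≤ MF)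
    (hGm : Measurable G) {MG : ℝ} (hMG : ∀ ω, |G ω| ≤ MG) : |cov[F, G; μ]| ≤ 2 * MF * MG := by
  obtain ⟨ω₀⟩ : Nonempty Ω := by
    by_contra h
    rw [not_nonempty_iff] at h
    have h1 := IsProbabilityMeasure.measure_univ (μ := μ)
    rw [Set.univ_eq_empty_iff.2 h, measure_empty] at h1
    exact zero_ne_one h1
  have hMF0 : 0 ≤ MF := (abs_nonneg _).trans (hMF ω₀)
  have hMG0 : 0 ≤ MG := (abs_nonneg _).trans (hMG ω₀)
  have hbound : ∀ {X : Ω → ℝ} {M : ℝ}, (∀ ω, |X ω| ≤ M) → |∫ ω, X ω ∂μ| ≤ M := fun {X M} hX => by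
    refine (abs_integral_le_integral_abs).trans ?_
    have h2 : ∫ ω, |X ω| ∂μ ≤ ∫ _ω, M ∂μ :=
      integral_mono_of_nonneg (ae_of_all _ fun ω => abs_nonneg _) (integrable_const _) (ae_of_all _ hX)
    simpa using h2
  rw [covariance_eq_sub_of_abs_le hFm hGm hMF hMG]
  have h1 : |∫ ω, F ω * G ω ∂μ| ≤ MF * MG := hbound fun ω => by
    rw [abs_mul]; exact mul_le_mul (hMF ω) (hMG ω) (abs_nonneg _) hMF0
  have h2 : |(∫ ω, F ω ∂μ) * ∫ ω, G ω ∂μ| ≤ MF * MG := by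
    rw [abs_mul]; exact mul_le_mul (hbound hMF) (hbound hMG) (abs_nonneg _) hMF0
  calc |(∫ ω, F ω * G ω ∂μ) - (∫ ω, F ω ∂μ) * ∫ ω, G ω ∂μ|
      ≤ |∫ ω, F ω * G ω ∂μ| + |(∫ ω, F ω ∂μ) * ∫ ω, G ω ∂μ| := abs_sub _ _
    _ ≤ MF * MG + MF * MG := add_le_add h1 h2
    _ = 2 * MF * MG := by ring

end Trivial

end Summit.Ventures.YMGap.RobustBall

end
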